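import Literature.NumberTheory.LFunctions.FeketePolyaKernelCertificatesBlockWrappers
import HarnessLib

/-!
# No real zero for real primitive characters of conductor `10748 ≤ q ≤ 11419`: the Fekete–Pólya rows, in the kernel (rows deferred by the earlier engines)

Topic `Literature/NumberTheory/LFunctions`; namespace `Literature.NumberTheory.LFunctions`. THEOREMS only (no
definition, no named fact, no `sorry`; standard axioms): one PUBLIC theorem **`noRealZero{Odd,Even}_fp_<q>`** per
fundamental discriminant `D`, `|D| = q ∈ [10748, 11419]`, that admits a Fekete–Pólya witness but was DEFERRED by the per-position engines v1/v2 (walk too long for one `decide`) — for every primitive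
quadratic `χ` mod `q` of the parity of `D` and every `σ ∈ (0, 1)`, `L(σ, χ) ≠ 0` (statement shape of the
`interval_cases` bullets of the `NoRealZero{Odd,Even}…` range files, so a range assembly cites them by name).
Cell `parity-realchar`, kernel floor of the wide column (TARGET §2 row 19), Fekete–Pólya lane (seat prover-2).

Method (engine v4): `FeketePolyaKernelCertificatesBlock{,Wrappers}.lean` — the iterated partial sums of order
`K` of the induced character `χ↑(q·w)` are non-negative over one period, decided in the kernel BLOCKWISE on packed
base-`2^b` digits (`blockCert b B K (q·w) (tabs… b ps q w)`: sign tables of the character from the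
quadratic-residue bitsets of the prime factors of the conductor — the factor list is part of each certificate,
primality by `norm_num` — prefix sums by one big-integer multiplication per order and block, sign test by one
AND), hence `ℜL(σ, χ↑(q·w)) > 0` (Fekete–Pólya 1912 / MV §11.2.1 Exercise 7) and `L(σ, χ) ≠ 0` (positive Euler
factors, Exercise 8).  Witnesses `(w, K)` = the cheapest in the exact integer scan of this seat
(`HOME/parity-realchar-prover-2/fp-witnesses-*.tsv`; no kit); the digit width `b` is two bits above the size of
the running-sum bound recorded by the scan.  14 characters in this file (est. 78 kernel-s).
NOT covered here (no Fekete–Pólya witness with `w ≤ 40`, `q·w ≤ 4·10⁵`, `K ≤ 12`; the other Fekete–Pólya rows of this range are in the `NoRealZeroFeketePolyaX…` files) — left to the truncation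
certificates of the companion lane: see those files.

## References

* H. L. Montgomery, R. C. Vaughan, *Multiplicative Number Theory I*, CUP 2007, §9.3 Thm 9.13, §11.2.1
  Exercises 7–8. [MontgomeryVaughan2007]
* M. Fekete, G. Pólya, *Über ein Problem von Laguerre*, Rend. Circ. Mat. Palermo 34 (1912) 89–120. [FeketePolya1912]
-/

namespace Literature.NumberTheory.LFunctions

open FeketePolyaKernel

set_option maxHeartbeats 400000 in
/-- `D = 10748`: the even character `χ₋₄·(·/2687)` of conductor `10748` (`2687`: prime) — Fekete–Pólya witness of order `6` along the induced modulus `10748·15 = 161220`, block certificate (digits of `87` bits, splitting depth `10`); est. `4.8` kernel-s. [cite: MontgomeryVaughan2007, §11.2.1 Exercises 7 (g), 8] -/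
theorem noRealZeroEven_fp_10748 :
    ∀ χ : DirichletCharacter ℂ 10748, χ.IsQuadratic → χ.IsPrimitive → χ.Even →
      ∀ σ : ℝ, 0 < σ → σ < 1 → χ.LFunction σ ≠ 0 :=
  good_even_of_four_blk [2687] (by norm_num) (by decide) (by decide) 15 6 87 10 (by decide) (by decide) (by decide)
    (Or.inr (by decide +kernel))

set_option maxHeartbeats 400000 in
/-- `D = 10749`: the even character `(·/10749)` of conductor `10749` (`10749`: 3 · 3583) — Fekete–Pólya witness of order `8` along the induced modulus `10749·22 = 236478`, block certificate (digits of `120` bits, splitting depth `10`); est. `10.6` kernel-s. [cite: MontgomeryVaughan2007, §11.2.1 Exercises 7 (g), 8] -/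
theorem noRealZeroEven_fp_10749 :
    ∀ χ : DirichletCharacter ℂ 10749, χ.IsQuadratic → χ.IsPrimitive → χ.Even →
      ∀ σ : ℝ, 0 < σ → σ < 1 → χ.LFunction σ ≠ 0 :=
  good_even_of_odd_blk [3, 3583] (by norm_num) (by decide) (by decide) 22 8 120 10 (by decide) (by decide) (by decide)
    (Or.inr (by decide +kernel))

set_option maxHeartbeats 400000 in
/-- `D = -10759`: the odd character `(·/10759)` of conductor `10759` (`10759`: 7 · 29 · 53) — Fekete–Pólya witness of order `5` along the induced modulus `10759·33 = 355047`, block certificate (digits of `79` bits, splitting depth `11`); est. `8.6` kernel-s. [cite: MontgomeryVaughan2007, §11.2.1 Exercises 7 (g), 8] -/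
theorem noRealZeroOdd_fp_10759 :
    ∀ χ : DirichletCharacter ℂ 10759, χ.IsQuadratic → χ.IsPrimitive → χ.Odd →
      ∀ σ : ℝ, 0 < σ → σ < 1 → χ.LFunction σ ≠ 0 :=
  good_odd_of_odd_blk [7, 29, 53] (by norm_num) (by decide) (by decide) 33 5 79 11 (by decide) (by decide) (by decide)
    (Or.inr (by decide +kernel))

set_option maxHeartbeats 400000 in
/-- `D = 10797`: the even character `(·/10797)` of conductor `10797` (`10797`: 3 · 59 · 61) — Fekete–Pólya witness of order `6` along the induced modulus `10797·10 = 107970`, block certificate (digits of `84` bits, splitting depth `9`); est. `3.2` kernel-s. [cite: MontgomeryVaughan2007, §11.2.1 Exercises 7 (g), 8] -/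
theorem noRealZeroEven_fp_10797 :
    ∀ χ : DirichletCharacter ℂ 10797, χ.IsQuadratic → χ.IsPrimitive → χ.Even →
      ∀ σ : ℝ, 0 < σ → σ < 1 → χ.LFunction σ ≠ 0 :=
  good_even_of_odd_blk [3, 59, 61] (by norm_num) (by decide) (by decide) 10 6 84 9 (by decide) (by decide) (by decide)
    (Or.inr (by decide +kernel))

set_option maxHeartbeats 400000 in
/-- `D = -10803`: the odd character `(·/10803)` of conductor `10803` (`10803`: 3 · 13 · 277) — Fekete–Pólya witness of order `4` along the induced modulus `10803·35 = 378105`, block certificate (digits of `61` bits, splitting depth `10`); est. `5.0` kernel-s. [cite: MontgomeryVaughan2007, §11.2.1 Exercises 7 (g), 8] -/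
theorem noRealZeroOdd_fp_10803 :
    ∀ χ : DirichletCharacter ℂ 10803, χ.IsQuadratic → χ.IsPrimitive → χ.Odd →
      ∀ σ : ℝ, 0 < σ → σ < 1 → χ.LFunction σ ≠ 0 :=
  good_odd_of_odd_blk [3, 13, 277] (by norm_num) (by decide) (by decide) 35 4 61 10 (by decide) (by decide) (by decide)
    (Or.inr (by decide +kernel))

set_option maxHeartbeats 400000 in
/-- `D = -10843`: the odd character `(·/10843)` of conductor `10843` (`10843`: 7 · 1549) — Fekete–Pólya witness of order `5` along the induced modulus `10843·15 = 162645`, block certificate (digits of `73` bits, splitting depth `10`); est. `4.0` kernel-s. [cite: MontgomeryVaughan2007, §11.2.1 Exercises 7 (g), 8] -/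
theorem noRealZeroOdd_fp_10843 :
    ∀ χ : DirichletCharacter ℂ 10843, χ.IsQuadratic → χ.IsPrimitive → χ.Odd →
      ∀ σ : ℝ, 0 < σ → σ < 1 → χ.LFunction σ ≠ 0 :=
  good_odd_of_odd_blk [7, 1549] (by norm_num) (by decide) (by decide) 15 5 73 10 (by decide) (by decide) (by decide)
    (Or.inr (by decide +kernel))

set_option maxHeartbeats 400000 in
/-- `D = 10856`: the even character `χ₈·(·/1357)` of conductor `10856` (`1357`: 23 · 59) — Fekete–Pólya witness of order `4` along the induced modulus `10856·21 = 227976`, block certificate (digits of `58` bits, splitting depth `9`); est. `3.0` kernel-s. [cite: MontgomeryVaughan2007, §11.2.1 Exercises 7 (g), 8] -/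
theorem noRealZeroEven_fp_10856 :
    ∀ χ : DirichletCharacter ℂ 10856, χ.IsQuadratic → χ.IsPrimitive → χ.Even →
      ∀ σ : ℝ, 0 < σ → σ < 1 → χ.LFunction σ ≠ 0 :=
  good_even_of_eight_blk [23, 59] (by norm_num) (by decide) (by decide) 21 4 58 9 (by decide) (by decide) (by decide)
    (Or.inl (by decide +kernel)) (Or.inr (by decide +kernel))

set_option maxHeartbeats 400000 in
/-- `D = -11023`: the odd character `(·/11023)` of conductor `11023` (`11023`: 73 · 151) — Fekete–Pólya witness of order `2` along the induced modulus `11023·33 = 363759`, block certificate (digits of `28` bits, splitting depth `9`); est. `1.6` kernel-s. [cite: MontgomeryVaughan2007, §11.2.1 Exercises 7 (g), 8] -/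
theorem noRealZeroOdd_fp_11023 :
    ∀ χ : DirichletCharacter ℂ 11023, χ.IsQuadratic → χ.IsPrimitive → χ.Odd →
      ∀ σ : ℝ, 0 < σ → σ < 1 → χ.LFunction σ ≠ 0 :=
  good_odd_of_odd_blk [73, 151] (by norm_num) (by decide) (by decide) 33 2 28 9 (by decide) (by decide) (by decide)
    (Or.inr (by decide +kernel))

set_option maxHeartbeats 400000 in
/-- `D = -11108`: the odd character `χ₋₄·(·/2777)` of conductor `11108` (`2777`: prime) — Fekete–Pólya witness of order `5` along the induced modulus `11108·11 = 122188`, block certificate (digits of `72` bits, splitting depth `9`); est. `3.1` kernel-s. [cite: MontgomeryVaughan2007, §11.2.1 Exercises 7 (g), 8] -/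
theorem noRealZeroOdd_fp_11108 :
    ∀ χ : DirichletCharacter ℂ 11108, χ.IsQuadratic → χ.IsPrimitive → χ.Odd →
      ∀ σ : ℝ, 0 < σ → σ < 1 → χ.LFunction σ ≠ 0 :=
  good_odd_of_four_blk [2777] (by norm_num) (by decide) (by decide) 11 5 72 9 (by decide) (by decide) (by decide)
    (Or.inr (by decide +kernel))

set_option maxHeartbeats 400000 in
/-- `D = -11139`: the odd character `(·/11139)` of conductor `11139` (`11139`: 3 · 47 · 79) — Fekete–Pólya witness of order `6` along the induced modulus `11139·13 = 144807`, block certificate (digits of `86` bits, splitting depth `10`); est. `4.2` kernel-s. [cite: MontgomeryVaughan2007, §11.2.1 Exercises 7 (g), 8] -/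
theorem noRealZeroOdd_fp_11139 :
    ∀ χ : DirichletCharacter ℂ 11139, χ.IsQuadratic → χ.IsPrimitive → χ.Odd →
      ∀ σ : ℝ, 0 < σ → σ < 1 → χ.LFunction σ ≠ 0 :=
  good_odd_of_odd_blk [3, 47, 79] (by norm_num) (by decide) (by decide) 13 6 86 10 (by decide) (by decide) (by decide)
    (Or.inr (by decide +kernel))

set_option maxHeartbeats 400000 in
/-- `D = -11188`: the odd character `χ₋₄·(·/2797)` of conductor `11188` (`2797`: prime) — Fekete–Pólya witness of order `8` along the induced modulus `11188·35 = 391580`, block certificate (digits of `126` bits, splitting depth `11`); est. `18.0` kernel-s. [cite: MontgomeryVaughan2007, §11.2.1 Exercises 7 (g), 8] -/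
theorem noRealZeroOdd_fp_11188 :
    ∀ χ : DirichletCharacter ℂ 11188, χ.IsQuadratic → χ.IsPrimitive → χ.Odd →
      ∀ σ : ℝ, 0 < σ → σ < 1 → χ.LFunction σ ≠ 0 :=
  good_odd_of_four_blk [2797] (by norm_num) (by decide) (by decide) 35 8 126 11 (by decide) (by decide) (by decide)
    (Or.inr (by decide +kernel))

set_option maxHeartbeats 400000 in
/-- `D = -11211`: the odd character `(·/11211)` of conductor `11211` (`11211`: 3 · 37 · 101) — Fekete–Pólya witness of order `8` along the induced modulus `11211·13 = 145743`, block certificate (digits of `115` bits, splitting depth `10`); est. `6.3` kernel-s. [cite: MontgomeryVaughan2007, §11.2.1 Exercises 7 (g), 8] -/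
theorem noRealZeroOdd_fp_11211 :
    ∀ χ : DirichletCharacter ℂ 11211, χ.IsQuadratic → χ.IsPrimitive → χ.Odd →
      ∀ σ : ℝ, 0 < σ → σ < 1 → χ.LFunction σ ≠ 0 :=
  good_odd_of_odd_blk [3, 37, 101] (by norm_num) (by decide) (by decide) 13 8 115 10 (by decide) (by decide) (by decide)
    (Or.inr (by decide +kernel))

set_option maxHeartbeats 400000 in
/-- `D = -11283`: the odd character `(·/11283)` of conductor `11283` (`11283`: 3 · 3761) — Fekete–Pólya witness of order `6` along the induced modulus `11283·10 = 112830`, block certificate (digits of `86` bits, splitting depth `9`); est. `3.5` kernel-s. [cite: MontgomeryVaughan2007, §11.2.1 Exercises 7 (g), 8] -/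
theorem noRealZeroOdd_fp_11283 :
    ∀ χ : DirichletCharacter ℂ 11283, χ.IsQuadratic → χ.IsPrimitive → χ.Odd →
      ∀ σ : ℝ, 0 < σ → σ < 1 → χ.LFunction σ ≠ 0 :=
  good_odd_of_odd_blk [3, 3761] (by norm_num) (by decide) (by decide) 10 6 86 9 (by decide) (by decide) (by decide)
    (Or.inr (by decide +kernel))

set_option maxHeartbeats 400000 in
/-- `D = -11407`: the odd character `(·/11407)` of conductor `11407` (`11407`: 11 · 17 · 61) — Fekete–Pólya witness of order `4` along the induced modulus `11407·15 = 171105`, block certificate (digits of `59` bits, splitting depth `9`); est. `2.3` kernel-s. [cite: MontgomeryVaughan2007, §11.2.1 Exercises 7 (g), 8] -/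
theorem noRealZeroOdd_fp_11407 :
    ∀ χ : DirichletCharacter ℂ 11407, χ.IsQuadratic → χ.IsPrimitive → χ.Odd →
      ∀ σ : ℝ, 0 < σ → σ < 1 → χ.LFunction σ ≠ 0 :=
  good_odd_of_odd_blk [11, 17, 61] (by norm_num) (by decide) (by decide) 15 4 59 9 (by decide) (by decide) (by decide)
    (Or.inr (by decide +kernel))

end Literature.NumberTheory.LFunctions
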